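import Summits.Ventures.LatticeQCDFlow.Scoring.TorusCylinderLimit2D
import HarnessLib

/-!
# The exact non-abelian area law in two dimensions, V-k: THE INFINITE-VOLUME LIMIT OF TWO-DIMENSIONAL LATTICE YANG–MILLS EXISTS AND IS UNIQUE AT EVERY COUPLING

HONEST FRAMING: exact (Metropolis-corrected) sampling algorithms for lattice gauge theory;
figures of merit are autocorrelation/cost numbers at stated couplings and volumes; no
continuum-physics claim.

Venture `LatticeQCDFlow` (cell pub-lqcd), sub-topic `Scoring`; FANOUT row 5 (`s0-sun-a`), GEN-19.
NEW WORK of the cell (placement rule).  Vocabulary of `Literature…QuantumLattice.LatticeGaugeDLR`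
(`IsInfiniteVolumeLimit`, `infiniteVolumeLimitPoints`, `HasUniqueInfiniteVolumeLimit`) and the soft
measure theory of `Literature…LatticeGaugeProofs` (`HasTorusLimits`, `torusMarginal_le_haar`,
`exists_limitState`, `tendsto_wilsonExpectation_of_subseq`, `measure_eq_of_integral_cylinder_eq`), written
there for the Osterwalder–Seiler STRONG-COUPLING theorem; here, in `d = 2`, NO COUPLING RESTRICTION:

* §1 **`hasTorusLimits_two`** — for every compact metrisable gauge group `G`, continuous `ρ` and EVERY real
  `β`, the torus expectations `⟨F ∘ torusLift⟩_{(ℤ/(L+1))²,β}` of every bounded measurable local observable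
  `F` of `G^{edges(ℤ²)}` converge as `L → ∞` (V-j for continuous cylinders; bounded measurable ones by
  `L¹(Haar^{⊗S})`-approximation and the domination of torus marginals by Haar measure — a Cauchy argument);
* §2 **`exists_infiniteVolumeLimit_two`**, **`hasUniqueInfiniteVolumeLimit_two`** — hence THE THERMODYNAMIC
  LIMIT `μ_β` OF THE TORUS WILSON STATES EXISTS, represents the limits of all bounded measurable cylinder
  observables, IS THE UNIQUE INFINITE-VOLUME LIMIT POINT (`infiniteVolumeLimitPoints ρ β = {μ_β}`, so
  `HasUniqueInfiniteVolumeLimit ρ β` — the conclusion (i) of `osterwalder_seiler_strongCoupling`, at ALL `β`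
  in two dimensions), and is invariant under the translations of `ℤ²`; **`integral_eq_freeBoundary_of_mem_two`** —
  IT IS THE FREE-BOUNDARY STATE: `∫ F dμ_β` is the free-boundary expectation of `F` on any box carrying `F`.

Published form: for `d = 2` the infinite-volume limit exists for all couplings because two-dimensional
lattice Yang–Mills with free boundary conditions factorises over plaquettes in an axial gauge (Gross–Witten
1980 §II; Seiler LNP 159 Ch. 2); here from the exponentially small finite-size corrections on the torus
(V-h) without gauge fixing.  No `def`, nothing cited as a fact, 0 sorry.
-/

noncomputable section

open MeasureTheory Function Finset Filter Topology
open Literature.MathematicalPhysics.QuantumFieldTheory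
open Literature.MathematicalPhysics.QuantumLattice
open Summit.Ventures.LatticeQCDFlow.Theory2.Lattice
open Summit.Ventures.LatticeQCDFlow.Theory2.Lattice.TwoDim

namespace Summit.Ventures.LatticeQCDFlow.Scoring


variable {G : Type*} [Group G] [TopologicalSpace G] [IsTopologicalGroup G]
  [CompactSpace G] [T2Space G] [SecondCountableTopology G] [MeasurableSpace G] [BorelSpace G] {N : ℕ}
  (ρ : G →* Matrix (Fin N) (Fin N) ℂ)

/-! ## §1. Every bounded measurable local observable has a thermodynamic limit -/

omit [IsTopologicalGroup G] [CompactSpace G] [T2Space G] [SecondCountableTopology G] [BorelSpace G] ρ in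
/-- A bounded measurable real function is integrable for a finite measure. -/
theorem integrable_of_abs_le' {α : Type*} [MeasurableSpace α] {μ : Measure α} [IsFiniteMeasure μ]
    {X : α → ℝ} (hX : Measurable X) {C : ℝ} (hC : ∀ ω, |X ω| ≤ C) : Integrable X μ :=
  Integrable.of_mem_Icc (-C) C hX.aemeasurable (ae_of_all _ fun ω => abs_le.1 (hC ω))

/-- **EVERY BOUNDED MEASURABLE LOCAL OBSERVABLE OF TWO-DIMENSIONAL LATTICE YANG–MILLS HAS A THERMODYNAMIC
LIMIT ALONG THE TORI, AT EVERY COUPLING**: `LatticeGaugeProofs.HasTorusLimits 2 ρ β` for every compact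
metrisable `G`, continuous `ρ`, real `β`.  (Continuous cylinders: V-j.  A bounded measurable cylinder `F`
with support `S` is within `ε` in `L¹(K·Haar^{⊗S})` of a continuous one, and the torus marginals on `S` are
dominated by `K·Haar^{⊗S}` (`torusMarginal_le_haar`), so the torus expectations of `F` form a Cauchy
sequence.) -/
theorem hasTorusLimits_two (hρ : Continuous ρ) (β : ℝ) : HasTorusLimits 2 ρ β := by
  intro F hF hFm hFb
  obtain ⟨S, hFS⟩ := hF
  obtain ⟨C, hC⟩ := hFb
  -- factor `F` through `G^S`
  set f : (↥S → G) → ℝ := fun u => F (padConfig S u) with hf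
  have hfF : ∀ U, F U = f (S.restrict U) := fun U =>
    (IsCylinder.apply_padConfig_restrict hFS U).symm
  have hfm : Measurable f := hFm.comp (measurable_padConfig S)
  have hfC : ∀ u, |f u| ≤ C := fun u => hC _
  -- domination of the torus marginals
  obtain ⟨K, hK⟩ := torusMarginal_le_haar ρ hρ β S
  set K' : ℝ := max K 0 with hK'
  have hK'0 : 0 ≤ K' := le_max_right _ _
  set haarS : Measure (↥S → G) := Measure.pi fun _ : ↥S => haarProbability G with hhaarS
  set ν : Measure (↥S → G) := K'.toNNReal • haarS with hν
  haveI : IsFiniteMeasure haarS := by rw [hhaarS]; infer_instance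
  -- the sequence of torus expectations is Cauchy
  set u : ℕ → ℝ := fun L => wilsonExpectation (L := L + 1) ρ β (toTorusObservable (L + 1) F) with hu
  suffices hcau : CauchySeq u from cauchySeq_tendsto_of_complete hcau
  refine Metric.cauchySeq_iff'.2 fun ε hε => ?_
  have hδ : 0 < ε / 5 := by positivity
  -- a continuous cylinder `ε/5`-close in `L¹(ν)`
  have hfi : Integrable f ν := integrable_of_abs_le' hfm hfC
  obtain ⟨g, hg, -⟩ := hfi.exists_boundedContinuous_integral_sub_le hδ
  set Gc : LGConfig 2 G → ℝ := fun U => g (S.restrict U) with hGc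
  have hGcS : IsCylinder Gc S := isCylinder_comp_restrict S g
  have hGcc : Continuous Gc := g.continuous.comp (by fun_prop)
  have hGcb : ∃ C, ∀ U, |Gc U| ≤ C :=
    ⟨‖g‖, fun U => by simpa [Real.norm_eq_abs] using g.norm_coe_le_norm (S.restrict U)⟩
  obtain ⟨ℓ', hℓ'⟩ := exists_tendsto_wilsonExpectation_cylinder ρ hρ β hGcS hGcc hGcb
  -- (a) the continuous cylinder's expectations are eventually `ε/5`-close to `ℓ'`
  obtain ⟨N₁, hN₁⟩ := Metric.tendsto_atTop.1 hℓ' (ε / 5) hδ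
  -- (b) the expectations of `F` and `Gc` are eventually `ε/5`-close
  have hdiff_m : Measurable fun v => |f v - g v| := (hfm.sub g.continuous.measurable).abs
  have hdiff_b : ∀ v, |f v - g v| ≤ C + ‖g‖ := fun v => by
    calc |f v - g v| ≤ |f v| + |g v| := abs_sub _ _
      _ ≤ C + ‖g‖ := add_le_add (hfC v) (by simpa [Real.norm_eq_abs] using g.norm_coe_le_norm v)
  have hgε : K' * ∫ v, |f v - g v| ∂haarS ≤ ε / 5 := by
    have h1 : ∫ v, |f v - g v| ∂ν = K' * ∫ v, |f v - g v| ∂haarS := by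
      rw [hν, integral_smul_nnreal_measure, NNReal.smul_def, Real.coe_toNNReal _ hK'0, smul_eq_mul]
    rw [← h1]
    simpa [Real.norm_eq_abs] using hg
  have hev : ∀ᶠ L : ℕ in atTop,
      |u L - wilsonExpectation (L := L + 1) ρ β (toTorusObservable (L + 1) Gc)| ≤ ε / 5 := by
    filter_upwards [hK] with L hKL
    have hmeas : ∀ {H : LGConfig 2 G → ℝ}, Measurable H →
        Measurable (toTorusObservable (G := G) (L + 1) H) := fun hH =>
      hH.comp (measurable_torusLift (L + 1))
    show |wilsonExpectation (L := L + 1) ρ β (toTorusObservable (L + 1) F) -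
        wilsonExpectation (L := L + 1) ρ β (toTorusObservable (L + 1) Gc)| ≤ ε / 5
    rw [← wilsonExpectation_sub ρ hρ β (hmeas hFm) (hmeas hGcc.measurable)
      ⟨C, fun U => hC _⟩ ⟨‖g‖, fun U => by
        simpa [Real.norm_eq_abs] using g.norm_coe_le_norm (S.restrict (torusLift (L+1) U))⟩]
    refine (abs_wilsonExpectation_le ρ β _).trans ?_
    have hrew : (fun U : GaugeConfig 2 (L + 1) G =>
        |toTorusObservable (L + 1) F U - toTorusObservable (L + 1) Gc U|) =
        toTorusObservable (L + 1) fun U => (fun v => |f v - g v|) (S.restrict U) := by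
      funext U
      simp only [toTorusObservable_apply, hfF, hGc]
    rw [hrew]
    refine (hKL (fun v => |f v - g v|) hdiff_m (fun v => abs_nonneg _) ⟨C + ‖g‖, hdiff_b⟩).trans ?_
    exact (mul_le_mul_of_nonneg_right (le_max_left _ _) (integral_nonneg fun v => abs_nonneg _)).trans hgε
  obtain ⟨N₂, hN₂⟩ := Filter.eventually_atTop.1 hev
  -- (c) combine
  refine ⟨max N₁ N₂, fun n hn => ?_⟩
  have hn₁ : N₁ ≤ n := le_of_max_le_left hn
  have hn₂ : N₂ ≤ n := le_of_max_le_right hn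
  have e1 := hN₂ n hn₂
  have e2 := hN₂ (max N₁ N₂) (le_max_right _ _)
  have e3 := hN₁ n hn₁
  have e4 := hN₁ (max N₁ N₂) (le_max_left _ _)
  rw [Real.dist_eq] at e3 e4 ⊢
  calc |u n - u (max N₁ N₂)|
      ≤ |u n - wilsonExpectation (L := n + 1) ρ β (toTorusObservable (n + 1) Gc)| +
        |wilsonExpectation (L := n + 1) ρ β (toTorusObservable (n + 1) Gc) - ℓ'| +
        |wilsonExpectation (L := max N₁ N₂ + 1) ρ β (toTorusObservable (max N₁ N₂ + 1) Gc) - ℓ'| +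
        |u (max N₁ N₂) -
          wilsonExpectation (L := max N₁ N₂ + 1) ρ β (toTorusObservable (max N₁ N₂ + 1) Gc)| := by
        have key : ∀ a b c d' : ℝ, |a - d'| ≤ |a - b| + |b - ℓ'| + |c - ℓ'| + |d' - c| := fun a b c d' => by
          calc |a - d'| = |(a - b) + (b - ℓ') - (c - ℓ') - (d' - c)| := by ring_nf
            _ ≤ |a - b| + |b - ℓ'| + |c - ℓ'| + |d' - c| := by
              have h1 := abs_add_le (a - b) (b - ℓ')
              have h2 := abs_sub ((a - b) + (b - ℓ')) (c - ℓ')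
              have h3 := abs_sub ((a - b) + (b - ℓ') - (c - ℓ')) (d' - c)
              linarith
        exact key _ _ _ _
    _ < ε := by linarith

/-! ## §2. The infinite-volume limit exists and is unique -/

/-- **THE THERMODYNAMIC LIMIT OF TWO-DIMENSIONAL LATTICE YANG–MILLS EXISTS, IS UNIQUE, AND IS TRANSLATION
INVARIANT, AT EVERY COUPLING** (every compact metrisable gauge group `G`, continuous representation `ρ`,
real `β`): there is a probability measure `μ_β` on `G^{edges(ℤ²)}` which is the infinite-volume limit of the
torus Wilson states (`IsInfiniteVolumeLimit ρ β μ_β`), represents the limits of the torus expectations of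
ALL bounded measurable cylinder observables, is the only infinite-volume limit point
(`infiniteVolumeLimitPoints ρ β = {μ_β}`), and is invariant under the translations of `ℤ²`. -/
theorem exists_infiniteVolumeLimit_two (hρ : Continuous ρ) (β : ℝ) :
    ∃ μ : Measure (LGConfig 2 G), IsProbabilityMeasure μ ∧ Literature.MathematicalPhysics.QuantumLattice.IsInfiniteVolumeLimit ρ β μ ∧
      infiniteVolumeLimitPoints ρ β = {μ} ∧
      (∀ (F : LGConfig 2 G → ℝ) (S : Finset ((Literature.MathematicalPhysics.QuantumLattice.ZdEdge 2))), IsCylinder F S → Measurable F →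
        (∃ C, ∀ U, |F U| ≤ C) →
        Tendsto (fun L : ℕ => wilsonExpectation (L := L + 1) ρ β (toTorusObservable (L + 1) F))
          atTop (𝓝 (∫ U, F U ∂μ))) ∧
      IsZdTranslationInvariant μ := by
  have hlim : HasTorusLimits 2 ρ β := hasTorusLimits_two ρ hρ β
  have hdom : HasMarginalDomination 2 ρ β := fun S => torusMarginal_le_haar ρ hρ β S
  obtain ⟨μ, hμp, hμc⟩ := exists_limitState ρ hρ hlim
  haveI := hμp
  have hid : ∀ (F : LGConfig 2 G → ℝ) (S : Finset ((Literature.MathematicalPhysics.QuantumLattice.ZdEdge 2))), IsCylinder F S → Measurable F →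
      (∃ C, ∀ U, |F U| ≤ C) →
      Tendsto (fun L : ℕ => wilsonExpectation (L := L + 1) ρ β (toTorusObservable (L + 1) F))
        atTop (𝓝 (∫ U, F U ∂μ)) := fun F S hFS hFm hFb =>
    tendsto_wilsonExpectation_of_subseq ρ hρ hlim hdom (φ := id) strictMono_id
      (by simpa using hμc) F S hFS hFm hFb
  have hlimit : Literature.MathematicalPhysics.QuantumLattice.IsInfiniteVolumeLimit ρ β μ :=
    ⟨hμp, fun F S hFS hFc hFb => by simpa using hμc F S hFS hFc hFb⟩
  have huniq : infiniteVolumeLimitPoints ρ β = {μ} := by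
    ext μ'
    simp only [Set.mem_singleton_iff]
    constructor
    · rintro ⟨φ, hφ, hμ'p, hμ'c⟩
      haveI := hμ'p
      have hid' := tendsto_wilsonExpectation_of_subseq ρ hρ hlim hdom hφ hμ'c
      exact measure_eq_of_integral_cylinder_eq fun F S hFS hFc hFb =>
        tendsto_nhds_unique (hid' F S hFS hFc.measurable hFb) (hid F S hFS hFc.measurable hFb)
    · rintro rfl
      exact hlimit.mem_infiniteVolumeLimitPoints
  refine ⟨μ, hμp, hlimit, huniq, hid, fun v => ?_⟩
  have hmem := map_configShift_mem_infiniteVolumeLimitPoints ρ hlimit.mem_infiniteVolumeLimitPoints v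
  rw [huniq] at hmem
  exact Set.mem_singleton_iff.1 hmem

/-- **`HasUniqueInfiniteVolumeLimit ρ β` IN TWO DIMENSIONS, AT EVERY COUPLING** (every compact metrisable
gauge group, every continuous representation, every real `β`) — the conclusion (i) of the Osterwalder–Seiler
strong-coupling property `Literature…osterwalder_seiler_strongCoupling`, with no restriction on `β`. -/
theorem hasUniqueInfiniteVolumeLimit_two (hρ : Continuous ρ) (β : ℝ) :
    HasUniqueInfiniteVolumeLimit (d := 2) ρ β := by
  obtain ⟨μ, -, hlimit, huniq, -, -⟩ := exists_infiniteVolumeLimit_two ρ hρ β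
  exact ⟨μ, hlimit, huniq⟩

/-- Every infinite-volume limit point in two dimensions IS the infinite-volume limit. -/
theorem isInfiniteVolumeLimit_of_mem_two (hρ : Continuous ρ) {β : ℝ} {μ : Measure (LGConfig 2 G)}
    (hμ : μ ∈ infiniteVolumeLimitPoints ρ β) :
    Literature.MathematicalPhysics.QuantumLattice.IsInfiniteVolumeLimit ρ β μ := by
  obtain ⟨μ₀, -, hlimit, huniq, -, -⟩ := exists_infiniteVolumeLimit_two ρ hρ β
  rw [huniq, Set.mem_singleton_iff] at hμ
  rw [hμ]
  exact hlimit

/-- Every infinite-volume limit point in two dimensions is translation invariant. -/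
theorem isZdTranslationInvariant_of_mem_two (hρ : Continuous ρ) {β : ℝ} {μ : Measure (LGConfig 2 G)}
    (hμ : μ ∈ infiniteVolumeLimitPoints ρ β) : IsZdTranslationInvariant μ := by
  obtain ⟨μ₀, -, -, huniq, -, hinv⟩ := exists_infiniteVolumeLimit_two ρ hρ β
  rw [huniq, Set.mem_singleton_iff] at hμ
  rw [hμ]
  exact hinv


/-- **THE INFINITE-VOLUME STATE IS THE FREE-BOUNDARY STATE**: for every infinite-volume limit point `μ` in two
dimensions and every bounded continuous cylinder observable `F` supported over an `R × T` box (edge set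
`E' ⊇ S` containing the box's links), `∫ F dμ = ∫ F(ū) ∏_{z∈box} w(ū_z) dHaar^{⊗E'} / ∫ ∏_{z∈box} w(ū_z) dHaar^{⊗E'}`
(`w = e^{−β(N − Re tr ρ)}`, `ū = padConfig E' u`) — the expectation of `F` in the free-boundary theory on the box. -/
theorem integral_eq_freeBoundary_of_mem_two (hρ : Continuous ρ) {β : ℝ} {μ : Measure (LGConfig 2 G)}
    (hμ : μ ∈ infiniteVolumeLimitPoints ρ β) {F : LGConfig 2 G → ℝ} {S E' : Finset ((Literature.MathematicalPhysics.QuantumLattice.ZdEdge 2))}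
    (hFS : IsCylinder F S) (hFc : Continuous F) {C : ℝ} (hFb : ∀ U, |F U| ≤ C) (hSE : S ⊆ E') {a b : ℤ}
    {R T : ℕ} (hS : ∀ s ∈ S, s.1 ∈ (range R ×ˢ range T).image (fun q : ℕ × ℕ => (![a + q.1, b + q.2] : (Literature.Probability.LatticeModels.Site 2))))
    (hE : ∀ z ∈ (range R ×ˢ range T).image (fun q : ℕ × ℕ => (![a + q.1, b + q.2] : (Literature.Probability.LatticeModels.Site 2))),
      ((z, 0) : (Literature.MathematicalPhysics.QuantumLattice.ZdEdge 2)) ∈ E' ∧ ((z + Pi.single 0 1, 1) : (Literature.MathematicalPhysics.QuantumLattice.ZdEdge 2)) ∈ E' ∧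
        ((z + Pi.single 1 1, 0) : (Literature.MathematicalPhysics.QuantumLattice.ZdEdge 2)) ∈ E' ∧ ((z, 1) : (Literature.MathematicalPhysics.QuantumLattice.ZdEdge 2)) ∈ E') :
    ∫ U, F U ∂μ =
      (∫ u, F (padConfig E' u) *
          ∏ z ∈ (range R ×ˢ range T).image (fun q : ℕ × ℕ => (![a + q.1, b + q.2] : (Literature.Probability.LatticeModels.Site 2))),
            Real.exp (-(β * ((N : ℝ) - (ρ (plaquetteHolonomyZd (padConfig E' u) z 0 1)).trace.re)))
          ∂(Measure.pi fun _ : ↥E' => haarProbability G)) /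
        ∫ u, ∏ z ∈ (range R ×ˢ range T).image (fun q : ℕ × ℕ => (![a + q.1, b + q.2] : (Literature.Probability.LatticeModels.Site 2))),
            Real.exp (-(β * ((N : ℝ) - (ρ (plaquetteHolonomyZd (padConfig E' u) z 0 1)).trace.re)))
          ∂(Measure.pi fun _ : ↥E' => haarProbability G) := by
  have hlimit := isInfiniteVolumeLimit_of_mem_two ρ hρ hμ
  have hA : Tendsto (fun L : ℕ => wilsonExpectation (L := L + 1) ρ β (toTorusObservable (L + 1) F)) atTop
      (𝓝 (∫ U, F U ∂μ)) := by
    simpa using hlimit.2 F S hFS hFc ⟨C, hFb⟩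
  exact tendsto_nhds_unique hA (tendsto_wilsonExpectation_cylinder_of_box ρ hρ β hFS hFc hFb hSE hS hE)

end Summit.Ventures.LatticeQCDFlow.Scoring
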